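import Summits.CriticalPhenomena.PercolationContinuityZ3.Theorems.Transplant.SkelRootChainW
import Summits.CriticalPhenomena.PercolationContinuityZ3.Theorems.Transplant.SkelPhiRootRooms
import Summits.CriticalPhenomena.PercolationContinuityZ3.Theorems.Transplant.SkelPhiRootBridgeGeom
import Summits.CriticalPhenomena.PercolationContinuityZ3.Theorems.Transplant.KNParaRootBridge
import Summits.CriticalPhenomena.PercolationContinuityZ3.Theorems.Transplant.SkelPhiWinChainS
import HarnessLib

/-!
# N1 (the `{±1}` node), (R) column (N1-R-PLAN v2 §4 (R4); NEG-SCOPE B.12/B.13): THE ROOT RESIDUE OF THE SCHEME OF RECORD FROM THE BRIDGE + A LONG RUN —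
# `Skelφ.rootOblTWAt_of_bridge`: `Skel.RootOblTWAt G ⟨cellGeomSG₂ G ψc P t Λ, q, δc⟩ Δ' δr du` from
#  * segment 1 = the BRIDGE: the one-step frame `B.bridgeFrame` (KNParaRootBridge) read through the signed root frame `rootFrame φ t σ` (SkelPhiRootBridgeGeom),
#  * segment 2 = ANY long-run frame `S₂` read through ANY 1-Lipschitz map `ψL` (the N1 run frames `runX/runY` of the oriented long map),
# in the root's ball window graph `winGraph G t Rπ` under the root-seed law `W0pin (edgesIn G A) U'`, with the rooms discharged from CELL-FOOTPRINT bounds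
# (`SkelPhiRootRooms`: level ∈ [−5r∥+1, 25r∥−1] and |⊥| ≤ 5r⊥−2 for the world, |level − 20r∥| ≤ 3r∥−1 and |⊥| ≤ 3r⊥−1 for the target box), the clearances
# from the along-coordinate of the root frame (`> k` on every region, `≤ k` on the pinned seed), the hop as one link input — via `Skel.rootOblTWAt_of_chain₂`.

What stays a hypothesis here (discharged by the companions): the footprint bounds of the two frames' regions / last core / hop prism and the cross link (pure arithmetic of
the run frames, `SkelPhiRootChainNRooms`), the nonempty true targets (column device), the kits and counts under the root-seed law (p1-g11's `kitClauseA/A′`, (R5)), the rim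
excesses (excess radius at `q`, (R4e)), and the numbers (stmt-g13's `NegB.*`, (R6)).
builds on p205010 (kernel theorem, internal audit signed; external expert review pending) — nothing in this file uses p205010; nothing here is a claim about the open node.
Lane `prim-bschramm`, seat `prim-bschramm-p3` (gen 9; design owner + (R) owner); helper file (`--supports stmt-CriticalPhenomena-4575 --as helper`).
[cite: KozmaNitzan2024, §4 p. 27 (G₀), p. 28 ((32) at the root), Lemma 11 (pp. 22–23), Lemma 12 (pp. 23–25)] [cite: MartineauTassion2017, §3.2, §4.3]
-/

noncomputable section

open MeasureTheory ProbabilityTheory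
open scoped ENNReal Classical

namespace Summit.CriticalPhenomena.PercolationContinuityZ3.Theorems

namespace Transplant

namespace Skelφ

open Literature.Probability.Percolation Literature.Probability.LatticeModels SimpleGraph GadgetSystem ProbeHistory HSiteScheme Contour KNCells
open Literature.Probability.Percolation.KozmaNitzan.Cells (oth sgOf stepVec_apply_fst)
open KNCells.KSchA KNLevels ChainPlanar
open Literature.Barriers.CriticalPhenomena (graphBall mem_graphBall_self graphBall_mono)
open BoxProdZ2 (ConcRadiiG)
open Skel (winGraph RootOblTWAt)

variable {V : Type} [DecidableEq V] [Countable V] {G : SimpleGraph V} [G.LocallyFinite] {φ ψc ψL : V → Site 2}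

/-- **The root-world footprint condition** of a cell position `z` in direction `du`: signed level `∈ [−5r∥ + 1, 25r∥ − 1]`, transverse `≤ 5r⊥ − 2` in absolute value.
[cite: KozmaNitzan2024, §4 p. 26 (Q_v, E_{v,x})] -/
def RootFoot (P : PCells2) (du : MDir) (z : Site 2) : Prop :=
  -(5 * (P.r du.1 : ℤ)) + 1 ≤ sgOf du * z du.1 ∧ sgOf du * z du.1 ≤ 25 * (P.r du.1 : ℤ) - 1 ∧ |z (oth du.1)| ≤ 5 * (P.r (oth du.1) : ℤ) - 2

/-- **The target-box footprint condition**: signed level within `3r∥ − 1` of `20r∥`, transverse `≤ 3r⊥ − 1`. [cite: KozmaNitzan2024, §4 p. 26 (M_v)] -/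
def TargetFoot (P : PCells2) (du : MDir) (z : Site 2) : Prop :=
  |sgOf du * z du.1 - 20 * (P.r du.1 : ℤ)| ≤ 3 * (P.r du.1 : ℤ) - 1 ∧ |z (oth du.1)| ≤ 3 * (P.r (oth du.1) : ℤ) - 1

/-- **THE ROOT RESIDUE AT ONE DIRECTION FROM THE BRIDGE AND A LONG RUN** (see the module docstring for the roles of the hypotheses).
[cite: KozmaNitzan2024, §4 p. 28 ((32) at the root), Lemma 11 (pp. 22–23), Lemma 12 (pp. 23–25)] -/
theorem rootOblTWAt_of_bridge (hlipφ : Lip G φ) (hlipc : Lip G ψc) (hwsc : WeakSteps G ψc) (hlipL : Lip G ψL)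
    (P : PCells2) (t : V) (Λ : ConcRadiiG) (q : unitInterval) (δc : ℝ) (du : MDir) {σ : ℤ} (hσ : σ = 1 ∨ σ = -1)
    {Rπ : ℕ} (hRQ : Rπ + 1 ≤ Λ.rQ 0 0) (hRB : Rπ + 1 ≤ Λ.rB 0 0 du) (hRQ' : Rπ + 1 ≤ Λ.rQ 0 ((0 : Site 2) + stepVec du))
    (hRM : Rπ + 1 ≤ Λ.rM 0 ((0 : Site 2) + stepVec du))
    -- the pinned seed
    {A : Finset V} (htA : t ∈ A) (hAconn : ∀ a ∈ A, PathIn G (↑A : Set V) t a) (hAπ : ∀ a ∈ A, a ∈ graphBall G t Rπ)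
    (hAfoot : ∀ a ∈ A, -(5 * (P.r du.1 : ℤ)) + 1 ≤ sgOf du * ψc a du.1 ∧ sgOf du * ψc a du.1 ≤ 5 * (P.r du.1 : ℤ) ∧ |ψc a (oth du.1)| ≤ 5 * (P.r (oth du.1) : ℤ) - 1)
    {kb : ℕ} (hAk : ∀ a ∈ A, |rootFrame φ t σ a 0| ≤ kb)
    -- the two frames and the chain data
    (B : BridgePrm) (hB : BridgeOK B) (S₂ : SchedFrame) (P₁ P₂ : WinChainData V)
    (hPo₁ : P₁.o = t) (hPo₂ : P₂.o = t)
    (hPS₁ : P₁.Sfin = ((⟨cellGeomSG₂ G ψc P t Λ, q, δc⟩ : KSchA V ℕ).U0root du).filter fun y => y ∈ graphBall G t Rπ)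
    (hPS₂ : P₂.Sfin = ((⟨cellGeomSG₂ G ψc P t Λ, q, δc⟩ : KSchA V ℕ).U0root du).filter fun y => y ∈ graphBall G t Rπ)
    (hRim₁ : ∀ k, P₁.Rim k ⊆ (planarWindowWin (lip_rootFrame hlipφ t hσ) t Rπ).stepDF (B.bridgeFrame hB) k)
    (hRim₂ : ∀ k, P₂.Rim k ⊆ (planarWindowWin hlipL t Rπ).stepDF S₂ k)
    (hRl₁ : P₁.Rlev + 1 ≤ B.R') (hRl₂ : P₂.Rlev + 1 ≤ S₂.R') (hj₁ : P₁.j₁ ≤ P₁.Rlev) (hj₂ : P₂.j₁ ≤ P₂.Rlev)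
    -- rooms: footprints of the regions and of the last core, clearances, nonempty targets, the cross link
    (hfoot₁ : ∀ w ∈ graphBall G t Rπ, rootFrame φ t σ w ∈ Finset.Icc B.regionLo B.regionHi → RootFoot P du (ψc w))
    (hfoot₂ : ∀ k ≤ S₂.N, ∀ w ∈ graphBall G t Rπ, ψL w ∈ S₂.region k → RootFoot P du (ψc w))
    (hclear₁ : (kb : ℤ) < B.B₀lo 0 - B.R' - B.pr)
    (hclear₂ : ∀ k ≤ S₂.N, ∀ w ∈ graphBall G t Rπ, ψL w ∈ S₂.region k → (kb : ℤ) < rootFrame φ t σ w 0)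
    (hTne₁ : (Win G (rootFrame φ t σ) t (Finset.Icc B.core1Lo B.core1Hi) Rπ).Nonempty)
    (hTne₂ : ∀ k ≤ S₂.N, (Win G ψL t (S₂.core (k + 1)) Rπ).Nonempty)
    (hx : ∀ w ∈ graphBall G t Rπ, rootFrame φ t σ w ∈ Finset.Icc B.core1Lo B.core1Hi → ψL w ∈ S₂.core 0)
    (hlastf : ∀ w ∈ graphBall G t Rπ, ψL w ∈ S₂.core (S₂.N + 1) → TargetFoot P du (ψc w))
    -- the hop: one link input valid for `P_q`, its prism inside the ball with root-world footprints, its target inside the hop box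
    {Δ' : ℕ} {δr : ℕ → ℝ} {η : ℝ} {Qp T₀ : Finset V}
    (hlink : 1 - δr (0 + 1 + S₂.N) < (bondPercolation G q).real (linkIn (↑Qp : Set V) A T₀))
    (hQπ : ∀ w ∈ Qp, w ∈ graphBall G t Rπ) (hQfoot : ∀ w ∈ Qp, RootFoot P du (ψc w))
    (hT₀ : ∀ w ∈ T₀, w ∈ graphBall G t Rπ ∧ rootFrame φ t σ w ∈ Finset.Icc B.B₀lo B.B₀hi)
    -- analytic inputs under the root-seed law (kits, counts, rim excesses) at accuracy `δr n`, `n = 1 + S₂.N`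
    (hcount₁ : 1 / (1 - (q : ℝ)) ^ (Δ' * P₁.N) ≤ δr (0 + 1 + S₂.N) * ((Finset.Icc P₁.j₀ P₁.j₁).card : ℝ))
    (hcount₂ : 1 / (1 - (q : ℝ)) ^ (Δ' * P₂.N) ≤ δr (0 + 1 + S₂.N) * ((Finset.Icc P₂.j₀ P₂.j₁).card : ℝ))
    (hkits₁ : ∀ k ≤ (B.bridgeFrame hB).N, ∀ j ∈ Finset.Icc P₁.j₀ P₁.j₁, ∃ (σk : SData V) (Sz : Finset V),
      SHyp (P₁.stepLF (planarWindowWin (lip_rootFrame hlipφ t hσ) t Rπ) (B.bridgeFrame hB) k) j σk ∧ σk.N ≤ P₁.N ∧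
      (1 - (q : ℝ) ^ σk.sB) ^ σk.k ≤ δr (0 + 1 + S₂.N) ∧ Sz ⊆ (P₁.stepLF (planarWindowWin (lip_rootFrame hlipφ t hσ) t Rπ) (B.bridgeFrame hB) k).X j ∧
      Sz ⊆ (planarWindowWin (lip_rootFrame hlipφ t hσ) t Rπ).stepDF (B.bridgeFrame hB) k ∧
      (∀ x ∈ σk.K, ∀ e' ∈ σk.seed x, e' ∉ wireSet (↑Sz : Set V)) ∧ (∀ x ∈ σk.K, σk.face x ⊆ Sz) ∧
      (∀ x ∈ σk.K, 1 - 3 * δr (0 + 1 + S₂.N) ≤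
        (prodBernoulli ((⟨cellGeomSG₂ G ψc P t Λ, q, δc⟩ : KSchA V ℕ).W0pin G (edgesIn G A)
          (((⟨cellGeomSG₂ G ψc P t Λ, q, δc⟩ : KSchA V ℕ).U0root du).filter fun y => y ∈ graphBall G t Rπ))).real
        {ω | ∃ u ∈ σk.face x, 1 - δr (0 + 1 + S₂.N) <
          (prodBernoulli (pinW ((⟨cellGeomSG₂ G ψc P t Λ, q, δc⟩ : KSchA V ℕ).W0pin G (edgesIn G A)
            (((⟨cellGeomSG₂ G ψc P t Λ, q, δc⟩ : KSchA V ℕ).U0root du).filter fun y => y ∈ graphBall G t Rπ)) (wireSet (↑Sz : Set V)) ω)).real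
            (⋃ t' ∈ P₁.coreEF (planarWindowWin (lip_rootFrame hlipφ t hσ) t Rπ) (B.bridgeFrame hB) k,
              openConnIn (↑((planarWindowWin (lip_rootFrame hlipφ t hσ) t Rπ).stepDF (B.bridgeFrame hB) k) : Set V) u t')}))
    (hkits₂ : ∀ k ≤ S₂.N, ∀ j ∈ Finset.Icc P₂.j₀ P₂.j₁, ∃ (σk : SData V) (Sz : Finset V),
      SHyp (P₂.stepLF (planarWindowWin hlipL t Rπ) S₂ k) j σk ∧ σk.N ≤ P₂.N ∧
      (1 - (q : ℝ) ^ σk.sB) ^ σk.k ≤ δr (0 + 1 + S₂.N) ∧ Sz ⊆ (P₂.stepLF (planarWindowWin hlipL t Rπ) S₂ k).X j ∧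
      Sz ⊆ (planarWindowWin hlipL t Rπ).stepDF S₂ k ∧
      (∀ x ∈ σk.K, ∀ e' ∈ σk.seed x, e' ∉ wireSet (↑Sz : Set V)) ∧ (∀ x ∈ σk.K, σk.face x ⊆ Sz) ∧
      (∀ x ∈ σk.K, 1 - 3 * δr (0 + 1 + S₂.N) ≤
        (prodBernoulli ((⟨cellGeomSG₂ G ψc P t Λ, q, δc⟩ : KSchA V ℕ).W0pin G (edgesIn G A)
          (((⟨cellGeomSG₂ G ψc P t Λ, q, δc⟩ : KSchA V ℕ).U0root du).filter fun y => y ∈ graphBall G t Rπ))).real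
        {ω | ∃ u ∈ σk.face x, 1 - δr (0 + 1 + S₂.N) <
          (prodBernoulli (pinW ((⟨cellGeomSG₂ G ψc P t Λ, q, δc⟩ : KSchA V ℕ).W0pin G (edgesIn G A)
            (((⟨cellGeomSG₂ G ψc P t Λ, q, δc⟩ : KSchA V ℕ).U0root du).filter fun y => y ∈ graphBall G t Rπ)) (wireSet (↑Sz : Set V)) ω)).real
            (⋃ t' ∈ P₂.coreEF (planarWindowWin hlipL t Rπ) S₂ k, openConnIn (↑((planarWindowWin hlipL t Rπ).stepDF S₂ k) : Set V) u t')}))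
    (hη : η ≤ δr (0 + 1 + S₂.N) / 2)
    (hexc₁ : ∀ k ≤ (B.bridgeFrame hB).N, (prodBernoulli ((⟨cellGeomSG₂ G ψc P t Λ, q, δc⟩ : KSchA V ℕ).W0pin G (edgesIn G A)
        (((⟨cellGeomSG₂ G ψc P t Λ, q, δc⟩ : KSchA V ℕ).U0root du).filter fun y => y ∈ graphBall G t Rπ))).real (⋃ t' ∈ P₁.Rim k, openConn t t') ≤ η)
    (hexc₂ : ∀ k ≤ S₂.N, (prodBernoulli ((⟨cellGeomSG₂ G ψc P t Λ, q, δc⟩ : KSchA V ℕ).W0pin G (edgesIn G A)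
        (((⟨cellGeomSG₂ G ψc P t Λ, q, δc⟩ : KSchA V ℕ).U0root du).filter fun y => y ∈ graphBall G t Rπ))).real (⋃ t' ∈ P₂.Rim k, openConn t t') ≤ η) :
    RootOblTWAt G (⟨cellGeomSG₂ G ψc P t Λ, q, δc⟩ : KSchA V ℕ) Δ' δr du := by
  set S : KSchA V ℕ := ⟨cellGeomSG₂ G ψc P t Λ, q, δc⟩ with hSdef
  set 𝒲₁ := planarWindowWin (lip_rootFrame hlipφ t hσ) t Rπ with h𝒲₁
  set 𝒲₂ := planarWindowWin hlipL t Rπ with h𝒲₂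
  set S₁ := B.bridgeFrame hB with hS₁
  have hroot : S.Γ.root = t := rfl
  -- footprints ⟹ the root world / the target box
  have hU : ∀ {w : V}, w ∈ graphBall G t Rπ → RootFoot P du (ψc w) → w ∈ (S.U0root du).filter fun y => y ∈ graphBall G t Rπ := by
    intro w hw hf
    exact Finset.mem_filter.2 ⟨mem_U0root_of_footprint P t Λ q δc du hlipc hwsc hRQ hRB hRQ' hw hf.1 hf.2.1 hf.2.2, hw⟩
  -- the seed lies in the root cube
  have hAQ : A ⊆ S.Γ.Q S.Γ.a₀ 0 := by
    intro a ha
    obtain ⟨h1, h2, h3⟩ := hAfoot a ha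
    exact mem_rootQ_of_footprint P t Λ du hlipc hwsc hRQ (hAπ a ha) h1 h2 h3
  -- regions of the bridge / long run: inside the world, off the seed
  have hDU₁ : ∀ k ≤ S₁.N, 𝒲₁.stepDF S₁ k ⊆ (S.U0root du).filter fun y => y ∈ graphBall G t Rπ := by
    intro k hk w hw
    obtain rfl : k = 0 := Nat.le_zero.1 hk
    change w ∈ Win G (rootFrame φ t σ) t (S₁.region 0) Rπ at hw
    rw [mem_Win] at hw
    exact hU hw.1 (hfoot₁ w hw.1 (by simpa [hS₁] using hw.2))
  have hDU₂ : ∀ k ≤ S₂.N, 𝒲₂.stepDF S₂ k ⊆ (S.U0root du).filter fun y => y ∈ graphBall G t Rπ := by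
    intro k hk w hw
    change w ∈ Win G ψL t (S₂.region k) Rπ at hw
    rw [mem_Win] at hw
    exact hU hw.1 (hfoot₂ k hk w hw.1 hw.2)
  have hDA₁ : ∀ k ≤ S₁.N, Disjoint (𝒲₁.stepDF S₁ k) A := by
    intro k hk
    obtain rfl : k = 0 := Nat.le_zero.1 hk
    change Disjoint (Win G (rootFrame φ t σ) t (S₁.region 0) Rπ) A
    refine Finset.disjoint_left.2 fun w hw hwA => ?_
    rw [mem_Win] at hw
    have h1 : B.B₀lo 0 - B.R' - B.pr ≤ rootFrame φ t σ w 0 := BridgePrm.le_of_mem_region (by simpa [hS₁] using hw.2) 0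
    have h2 := (abs_le.1 (hAk w hwA)).2
    linarith
  have hDA₂ : ∀ k ≤ S₂.N, Disjoint (𝒲₂.stepDF S₂ k) A := by
    intro k hk
    change Disjoint (Win G ψL t (S₂.region k) Rπ) A
    refine Finset.disjoint_left.2 fun w hw hwA => ?_
    rw [mem_Win] at hw
    have h1 := hclear₂ k hk w hw.1 hw.2
    have h2 := (abs_le.1 (hAk w hwA)).2
    linarith
  -- nonempty true targets
  have hTne₁' : ∀ k ≤ S₁.N, (𝒲₁.coreTF S₁ k).Nonempty := by
    intro k hk
    obtain rfl : k = 0 := Nat.le_zero.1 hk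
    change (Win G (rootFrame φ t σ) t (S₁.core (0 + 1)) Rπ).Nonempty
    simpa [hS₁] using hTne₁
  have hTne₂' : ∀ k ≤ S₂.N, (𝒲₂.coreTF S₂ k).Nonempty := fun k hk => hTne₂ k hk
  -- the cross link and the last core
  have hx' : 𝒲₁.coreTF S₁ S₁.N ⊆ 𝒲₂.W (S₂.core 0) := by
    intro w hw
    change w ∈ Win G (rootFrame φ t σ) t (S₁.core (S₁.N + 1)) Rπ at hw
    change w ∈ Win G ψL t (S₂.core 0) Rπ
    rw [mem_Win] at hw ⊢
    exact ⟨hw.1, hx w hw.1 (by simpa [hS₁] using hw.2)⟩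
  have hlast : 𝒲₂.coreTF S₂ S₂.N ⊆ S.Γ.M S.Γ.a₀ ((0 : Site 2) + stepVec du) := by
    intro w hw
    change w ∈ Win G ψL t (S₂.core (S₂.N + 1)) Rπ at hw
    rw [mem_Win] at hw
    obtain ⟨ha, hb⟩ := hlastf w hw.1 hw.2
    exact mem_rootM_of_footprint P t Λ du hlipc hwsc hRM hw.1 ha hb
  -- the hop's prism inside the world, its target inside the first level
  have hQU : Qp ⊆ (S.U0root du).filter fun y => y ∈ graphBall G t Rπ := fun w hw => hU (hQπ w hw) (hQfoot w hw)
  have hT₀' : T₀ ⊆ 𝒲₁.W (S₁.core 0) := by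
    intro w hw
    obtain ⟨hπ, hbox⟩ := hT₀ w hw
    change w ∈ Win G (rootFrame φ t σ) t (S₁.core 0) Rπ
    rw [mem_Win]
    exact ⟨hπ, by simpa [hS₁] using hbox⟩
  have hN : S₁.N + 1 + S₂.N = 0 + 1 + S₂.N := by simp [hS₁]
  -- assemble
  refine Skel.rootOblTWAt_of_chain₂ (S := S) hAQ hAπ htA hAconn 𝒲₁ 𝒲₂ S₁ S₂ P₁ P₂ hPo₁ hPo₂ hPS₁ hPS₂ hRim₁ hRim₂ hRl₁ hRl₂ hj₁ hj₂
    hTne₁' hTne₂' hDU₁ hDU₂ hDA₁ hDA₂ hx' hlast (hN ▸ hlink) hQU hT₀' (hN ▸ hcount₁) (hN ▸ hcount₂) (hN ▸ hkits₁) (hN ▸ hkits₂) (hN ▸ hη)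
    hexc₁ hexc₂

end Skelφ

end Transplant

end Summit.CriticalPhenomena.PercolationContinuityZ3.Theorems

end
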